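import Summits.AtomisticToContinuum.HydrodynamicLimit.Theses.MourreKoopmanCharges
import Summits.AtomisticToContinuum.HydrodynamicLimit.Theorems.MourreKoopmanChargesConservedVectorsOneBodyCesaro
import Summits.AtomisticToContinuum.HydrodynamicLimit.Theorems.MourreKoopmanChargesOneBodyCompletenessTorusMoments
import Summits.AtomisticToContinuum.HydrodynamicLimit.Theorems.MourreKoopmanChargesOneBodyCompletenessWindowPassage
import Summits.AtomisticToContinuum.HydrodynamicLimit.Theorems.MourreKoopmanChargesIdealGasNoDecay
import Literature.MathematicalPhysics.KineticTheory.FluctuationSpace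
import Literature.Analysis.FluidPDE.InfiniteHardSphereFlow
import HarnessLib

/-!
# `OneBodyCompleteness` (crux stmt-AtomisticToContinuum-9583, route `MourreKoopmanCharges`):
# reduction to the unit-diameter fluctuation framework and `ChargesCompleteHS`

Helper file (`--supports stmt-AtomisticToContinuum-9583`, line `registered`, skeleton v3 of
`Cruxes/OneBodyCompleteness/Lines/birth.lean`). The crux is the Euler-window Cesàro decay
`|S⁻¹∫₀^S (N+1)·E_eq[A_h(χ)(Φ_{s(N+1)^{-1/3}}z)·A_h(χ)(z)] ds| ≤ δ` of the two-time moments of a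
one-body empirical field `A_h(χ) = (N+1)⁻¹ Σ χ(xᵢ)h(vᵢ)`, `h ⊥ {1, v, |v|²}` in `L²(M_θ)`, of
`N + 1` hard spheres of diameter `σ(N+1)^{-1/3}` on `𝕋³` under the canonical law
`localGibbsLaw σ 1 0 θ`. This file proves, with nothing admitted,

  `oneBodyCompleteness_of_framework : (framework) → (identification) → ChargesCompleteHS → OneBodyCompleteness`,

where the two hypotheses are the registered stubs of the line, written out in full:

* FRAMEWORK (support item 9702 (1) at unit diameter / unit inverse temperature): for every
  activity target `z₀` a reduced-diameter threshold `σ₁` below which some Gibbs(1, z, 1) state with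
  `z < z₀` and density `σ³`, carried by Alexander's flow, is packaged as
  `HardSphereFluctuationData 1` with strongly continuous Koopman group, one-body cell observables in
  `𝒱`, and Maxwellian orthogonality `[A_g] ⊥ 𝒞` for `g ⊥ {1, v, |v|²}` in `L²(M_1)`;
* IDENTIFICATION (support item 9702 (2), diagonal, through the hard-sphere scaling dictionary —
  blow-up by `ε_N⁻¹` in space and `√θ/ε_N` in time maps the torus system to unit spheres at density
  `σ³` with `M_1` velocities): `(N+1)·cov_N(s) → (∫χ²)·K·⟪U_{(√θ/σ)s}[A_{h_θ}], [A_{h_θ}]⟫_{ℋ_F}`,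
  `h_θ = h(√θ ·)`;

and `ChargesCompleteHS` is the route's crux #3 (stmt-14141: completeness of the five charges in
`ℋ_F`, Doyon 2022 §1 open problem), used at `σ = β = 1`. The torus side is supplied by the landed
`stub_torusMoments` (cov = raw moment, domination) and `stub_windowPassage` (dominated window
passage), the Hilbert-space side by von Neumann's mean ergodic theorem in `ℋ_F` (`meanErgodic`, from
the tree's `drudeWeight_eq_zero_iff_tendsto_cesaro`), plus the Gaussian change-of-temperature
identities (`integral_mul_localMaxwellian_eq_comp_sqrt`, `orthogonal_comp_sqrt`).

References: H. Spohn, *Large Scale Dynamics of Interacting Particles* (1991), Part I §7.1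
(7.13)–(7.18); B. Doyon, Comm. Math. Phys. 391 (2022) §1, Thm 5.1; J. von Neumann (1932).
-/

noncomputable section

namespace Summit.AtomisticToContinuum.HydrodynamicLimit.Theorems.MourreKoopmanChargesOneBodyCompleteness

open scoped BigOperators Topology InnerProductSpace ENNReal
open Filter Set Function MeasureTheory ProbabilityTheory
open Summit.AtomisticToContinuum.HydrodynamicLimit.Theses.MourreKoopmanCharges
  (OneBodyCompleteness ChargesCompleteHS)

/-! ### Hilbert-space side and Gaussian calculus -/

/-- VON NEUMANN'S MEAN ERGODIC THEOREM, continuous parameter, in `ℋ_F` (the birth skeleton's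
registered stub `stub_meanErgodic`, proved): for a strongly continuous Koopman group the Cesàro means of
`⟪U_s ψ, ψ⟫` vanish for `ψ ⊥ 𝒬₀ = conservedSpace` (tree: the Cesàro limit is the Drude weight
`‖P_{𝒬₀} ψ‖²`, `MourreKoopmanChargesConservedVectorsOneBody.drudeWeight_eq_zero_iff_tendsto_cesaro`,
through `Mazur.tendsto_timeAverage`). [von Neumann 1932; Doyon2022 Thm 5.1] -/
theorem meanErgodic (σ : ℝ) (F : Literature.MathematicalPhysics.KineticTheory.HardSphereFluctuationData σ)
    (hU : ∀ ψ : Literature.MathematicalPhysics.KineticTheory.HardSphereFluctuationSpace F,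
      Continuous fun t : ℝ => F.koopman t ψ)
    (ψ : Literature.MathematicalPhysics.KineticTheory.HardSphereFluctuationSpace F)
    (hψ : ∀ φ ∈ F.conservedSpace, ⟪ψ, φ⟫_ℝ = 0) :
    Tendsto (fun S : ℝ => S⁻¹ * ∫ s in (0 : ℝ)..S, ⟪F.koopman s ψ, ψ⟫_ℝ) atTop (𝓝 0) := by
  have hSC : F.IsStronglyContinuous := hU
  have hmem : ψ ∈ F.conservedSpaceᗮ := (Submodule.mem_orthogonal' _ _).2 hψ
  have h0 : F.drudeWeight ψ = 0 := (F.drudeWeight_eq_zero_iff ψ).2 hmem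
  exact (Summit.AtomisticToContinuum.HydrodynamicLimit.Theorems.MourreKoopmanChargesConservedVectorsOneBody.drudeWeight_eq_zero_iff_tendsto_cesaro
    F.toFluctuationDynamics hSC ψ).1 h0

/-- Time-rescaled Cesàro means: if `S⁻¹∫₀^S φ → 0` then `S⁻¹∫₀^S φ(κ s) ds → 0` for `κ > 0`
(substitution `u = κ s`). [folklore] -/
theorem tendsto_cesaro_comp_mul {φ : ℝ → ℝ} {κ : ℝ} (hκ : 0 < κ)
    (h : Tendsto (fun S : ℝ => S⁻¹ * ∫ s in (0 : ℝ)..S, φ s) atTop (𝓝 0)) :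
    Tendsto (fun S : ℝ => S⁻¹ * ∫ s in (0 : ℝ)..S, φ (κ * s)) atTop (𝓝 0) := by
  have h1 : Tendsto (fun S : ℝ => (κ * S)⁻¹ * ∫ s in (0 : ℝ)..(κ * S), φ s) atTop (𝓝 0) :=
    h.comp (Tendsto.const_mul_atTop hκ tendsto_id)
  refine h1.congr fun S => ?_
  rw [intervalIntegral.integral_comp_mul_left φ hκ.ne', mul_zero, smul_eq_mul, mul_inv]
  ring

/-- A convergent real sequence is bounded above by a constant (with the bound usable at every index). [folklore] -/
theorem exists_forall_le_of_tendsto {u : ℕ → ℝ} {a : ℝ} (h : Tendsto u atTop (𝓝 a)) :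
    ∃ M : ℝ, ∀ n, u n ≤ M := by
  obtain ⟨M, hM⟩ := h.bddAbove_range
  exact ⟨M, fun n => hM ⟨n, rfl⟩⟩

/-- Change of temperature in Maxwellian averages: `∫ g M_θ dv = ∫ g(√θ w) M_1(w) dw` (both are
`E[g(√θ W)]` for a standard Gaussian `W`). [folklore] -/
theorem integral_mul_localMaxwellian_eq_comp_sqrt {θ : ℝ} (hθ : 0 < θ)
    (g : Literature.MathematicalPhysics.KineticTheory.V3 → ℝ) :
    ∫ v, g v * Literature.Analysis.FluidPDE.localMaxwellian 1 θ
        (0 : Literature.MathematicalPhysics.KineticTheory.V3) v =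
      ∫ w, g (Real.sqrt θ • w) * Literature.Analysis.FluidPDE.localMaxwellian 1 1
        (0 : Literature.MathematicalPhysics.KineticTheory.V3) w := by
  rw [← Summit.AtomisticToContinuum.HydrodynamicLimit.Theorems.MourreKoopmanChargesIdealGasNoDecay.integral_gaussMeasure_eq_integral_mul hθ g,
    ← Summit.AtomisticToContinuum.HydrodynamicLimit.Theorems.MourreKoopmanChargesIdealGasNoDecay.integral_gaussMeasure_eq_integral_mul one_pos,
    Literature.MathematicalPhysics.KineticTheory.integral_gaussMeasure _ hθ,
    Literature.MathematicalPhysics.KineticTheory.integral_gaussMeasure _ one_pos]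
  simp

/-- Polynomial growth is stable under the velocity rescaling `w ↦ √θ w`. [folklore] -/
theorem poly_bound_comp_sqrt {θ : ℝ} {h : Literature.MathematicalPhysics.KineticTheory.V3 → ℝ}
    (hb : ∃ (C : ℝ) (k : ℕ), ∀ v, |h v| ≤ C * (1 + ‖v‖) ^ k) :
    ∃ (C : ℝ) (k : ℕ), ∀ w : Literature.MathematicalPhysics.KineticTheory.V3,
      |h (Real.sqrt θ • w)| ≤ C * (1 + ‖w‖) ^ k := by
  obtain ⟨C, k, hC⟩ := hb
  have hC0 : 0 ≤ C := by
    have h0 := hC 0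
    simp only [norm_zero, add_zero, one_pow, mul_one] at h0
    exact (abs_nonneg _).trans h0
  refine ⟨C * (max 1 (Real.sqrt θ)) ^ k, k, fun w => ?_⟩
  have hm1 : 1 ≤ max 1 (Real.sqrt θ) := le_max_left _ _
  have hm2 : Real.sqrt θ ≤ max 1 (Real.sqrt θ) := le_max_right _ _
  have hle : 1 + ‖Real.sqrt θ • w‖ ≤ max 1 (Real.sqrt θ) * (1 + ‖w‖) := by
    rw [norm_smul, Real.norm_of_nonneg (Real.sqrt_nonneg θ), mul_add, mul_one]
    exact add_le_add hm1 (mul_le_mul_of_nonneg_right hm2 (norm_nonneg _))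
  calc |h (Real.sqrt θ • w)| ≤ C * (1 + ‖Real.sqrt θ • w‖) ^ k := hC _
    _ ≤ C * (max 1 (Real.sqrt θ) * (1 + ‖w‖)) ^ k :=
        mul_le_mul_of_nonneg_left (pow_le_pow_left₀ (by positivity) hle k) hC0
    _ = C * (max 1 (Real.sqrt θ)) ^ k * (1 + ‖w‖) ^ k := by rw [mul_pow]; ring

/-- Maxwellian orthogonality transfers along the velocity rescaling: if `h ⊥ {1, v, |v|²}` in
`L²(M_θ)` then `h_θ = h(√θ ·) ⊥ {1, v, |v|²}` in `L²(M_1)`. [folklore] -/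
theorem orthogonal_comp_sqrt {θ : ℝ} (hθ : 0 < θ)
    {h : Literature.MathematicalPhysics.KineticTheory.V3 → ℝ}
    (hm0 : ∫ v, h v * Literature.Analysis.FluidPDE.localMaxwellian 1 θ
      (0 : Literature.MathematicalPhysics.KineticTheory.V3) v = 0)
    (hm1 : ∀ i : Fin 3, ∫ v, h v * v i * Literature.Analysis.FluidPDE.localMaxwellian 1 θ
      (0 : Literature.MathematicalPhysics.KineticTheory.V3) v = 0)
    (hm2 : ∫ v, h v * ‖v‖ ^ 2 * Literature.Analysis.FluidPDE.localMaxwellian 1 θ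
      (0 : Literature.MathematicalPhysics.KineticTheory.V3) v = 0) :
    (∫ w, h (Real.sqrt θ • w) * Literature.Analysis.FluidPDE.localMaxwellian 1 1
        (0 : Literature.MathematicalPhysics.KineticTheory.V3) w = 0) ∧
    (∀ i : Fin 3, ∫ w, h (Real.sqrt θ • w) * w i * Literature.Analysis.FluidPDE.localMaxwellian 1 1
        (0 : Literature.MathematicalPhysics.KineticTheory.V3) w = 0) ∧
    (∫ w, h (Real.sqrt θ • w) * ‖w‖ ^ 2 * Literature.Analysis.FluidPDE.localMaxwellian 1 1
        (0 : Literature.MathematicalPhysics.KineticTheory.V3) w = 0) := by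
  have hsq : Real.sqrt θ ≠ 0 := (Real.sqrt_pos.2 hθ).ne'
  refine ⟨?_, fun i => ?_, ?_⟩
  · rw [← integral_mul_localMaxwellian_eq_comp_sqrt hθ h]
    exact hm0
  · have e := integral_mul_localMaxwellian_eq_comp_sqrt hθ (fun v => h v * v i)
    rw [hm1 i] at e
    simp only [PiLp.smul_apply, smul_eq_mul] at e
    have e2 : ∫ w, h (Real.sqrt θ • w) * (Real.sqrt θ * w i) *
        Literature.Analysis.FluidPDE.localMaxwellian 1 1
          (0 : Literature.MathematicalPhysics.KineticTheory.V3) w =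
        Real.sqrt θ * ∫ w, h (Real.sqrt θ • w) * w i *
          Literature.Analysis.FluidPDE.localMaxwellian 1 1
            (0 : Literature.MathematicalPhysics.KineticTheory.V3) w := by
      rw [← integral_const_mul]
      refine integral_congr_ae (ae_of_all _ fun w => ?_)
      ring
    rw [e2] at e
    exact (mul_eq_zero.1 e.symm).resolve_left hsq
  · have e := integral_mul_localMaxwellian_eq_comp_sqrt hθ (fun v => h v * ‖v‖ ^ 2)
    rw [hm2] at e
    have e2 : ∫ w, h (Real.sqrt θ • w) * ‖Real.sqrt θ • w‖ ^ 2 *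
        Literature.Analysis.FluidPDE.localMaxwellian 1 1
          (0 : Literature.MathematicalPhysics.KineticTheory.V3) w =
        θ * ∫ w, h (Real.sqrt θ • w) * ‖w‖ ^ 2 *
          Literature.Analysis.FluidPDE.localMaxwellian 1 1
            (0 : Literature.MathematicalPhysics.KineticTheory.V3) w := by
      rw [← integral_const_mul]
      refine integral_congr_ae (ae_of_all _ fun w => ?_)
      dsimp only
      rw [norm_smul, Real.norm_of_nonneg (Real.sqrt_nonneg θ), mul_pow, Real.sq_sqrt hθ.le]
      ring
    rw [e2] at e
    exact (mul_eq_zero.1 e.symm).resolve_left hθ.ne'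

/-! ### The reduction -/

/-- **REDUCTION OF THE CRUX** (kernel-checked, axiom-clean): the unit-diameter fluctuation
framework `h1` (= registered stub `stub_gibbsFluctuationDataUnit` of line `registered`), the
unit-diameter diagonal torus ↔ infinite-volume identification `h2` (= registered stub
`stub_torusIdentificationUnit`) and the route item `ChargesCompleteHS` (stmt-14141, used at
`σ = β = 1`) imply the crux `MourreKoopmanCharges.OneBodyCompleteness` BY NAME, the torus side being supplied by the landed
`stub_torusMoments` / `stub_windowPassage` and the mean ergodic theorem. Proof: `z₀` from
`ChargesCompleteHS 1 1`, `z₂` from the identification, `σ₁ := σ₁(min z₀ z₂)` from the framework,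
`σ₀ := min σ₁ 2⁻¹`; for `σ < σ₀`, `θ > 0`, `h` as in the crux put `h_θ := h(√θ ·)` (continuous,
polynomially bounded, `⊥ {1, v, |v|²}` in `L²(M_1)`); the framework datum `F` has complete charges,
so `ψ = [A_{h_θ}] ⊥ 𝒬₀` and the Cesàro means of `⟪U_u ψ, ψ⟫`, hence of
`c(s) = K⟪U_{κ s} ψ, ψ⟫` (`κ = √θ/σ > 0`), vanish; identification + torus moments give pointwise
convergence of the raw two-time moments `f_N(s) → (∫χ²) c(s)` with `|f_N(s)| ≤ f_N(0) ≤ M`; window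
passage and `δ/2 + δ/2`. -/
theorem oneBodyCompleteness_of_framework :
    (∀ z₀ : ℝ, 0 < z₀ → ∃ σ₁ : ℝ, 0 < σ₁ ∧ ∀ σ : ℝ, 0 < σ → σ < σ₁ →
      ∃ (F : Literature.MathematicalPhysics.KineticTheory.HardSphereFluctuationData 1) (z : ℝ),
        0 < z ∧ z < z₀ ∧
        Literature.Analysis.FluidPDE.IsHardSphereGibbs 1 z 1
          (0 : Literature.MathematicalPhysics.KineticTheory.V3) F.μ ∧
        (∃ Φ : Literature.Analysis.FluidPDE.InfiniteHardSphereFlow (Fin 3) 1,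
          Φ.IsEquilibriumFlow ∧ ∀ t : ℝ, F.flow t =ᵐ[F.μ] Φ.flow t) ∧
        (∫ ω, Literature.MathematicalPhysics.KineticTheory.cellCharge 0 ω ∂F.μ = σ ^ 3) ∧
        (∀ ψ : Literature.MathematicalPhysics.KineticTheory.HardSphereFluctuationSpace F,
          Continuous fun t : ℝ => F.koopman t ψ) ∧
        (∀ g : Literature.MathematicalPhysics.KineticTheory.V3 → ℝ, Continuous g →
          (∃ (C : ℝ) (k : ℕ), ∀ v, |g v| ≤ C * (1 + ‖v‖) ^ k) →
          Literature.MathematicalPhysics.KineticTheory.cellObs g ∈ F.localObs ∧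
          ((∫ v, g v * Literature.Analysis.FluidPDE.localMaxwellian 1 1
              (0 : Literature.MathematicalPhysics.KineticTheory.V3) v = 0) →
           (∀ i : Fin 3, ∫ v, g v * v i * Literature.Analysis.FluidPDE.localMaxwellian 1 1
              (0 : Literature.MathematicalPhysics.KineticTheory.V3) v = 0) →
           (∫ v, g v * ‖v‖ ^ 2 * Literature.Analysis.FluidPDE.localMaxwellian 1 1
              (0 : Literature.MathematicalPhysics.KineticTheory.V3) v = 0) →
           ∀ i : Fin 5, ⟪F.fluct (Literature.MathematicalPhysics.KineticTheory.cellObs g),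
              F.chargeClass i⟫_ℝ = 0))) →
    (∃ z₂ : ℝ, 0 < z₂ ∧ ∀ σ : ℝ, 0 < σ → σ < 1 / 2 → ∀ z : ℝ, 0 < z → z < z₂ → ∀ θ : ℝ, 0 < θ →
      ∀ F : Literature.MathematicalPhysics.KineticTheory.HardSphereFluctuationData 1,
        Literature.Analysis.FluidPDE.IsHardSphereGibbs 1 z 1
          (0 : Literature.MathematicalPhysics.KineticTheory.V3) F.μ →
        (∃ Φ : Literature.Analysis.FluidPDE.InfiniteHardSphereFlow (Fin 3) 1,
          Φ.IsEquilibriumFlow ∧ ∀ t : ℝ, F.flow t =ᵐ[F.μ] Φ.flow t) →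
        (∫ ω, Literature.MathematicalPhysics.KineticTheory.cellCharge 0 ω ∂F.μ = σ ^ 3) →
        ∀ h : Literature.MathematicalPhysics.KineticTheory.V3 → ℝ, Continuous h →
          (∃ (C : ℝ) (k : ℕ), ∀ v, |h v| ≤ C * (1 + ‖v‖) ^ k) →
          Literature.MathematicalPhysics.KineticTheory.cellObs (fun w => h (Real.sqrt θ • w)) ∈ F.localObs →
          (∫ v, h v * Literature.Analysis.FluidPDE.localMaxwellian 1 θ
              (0 : Literature.MathematicalPhysics.KineticTheory.V3) v = 0) →
          (∀ i : Fin 3, ∫ v, h v * v i * Literature.Analysis.FluidPDE.localMaxwellian 1 θ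
              (0 : Literature.MathematicalPhysics.KineticTheory.V3) v = 0) →
          (∫ v, h v * ‖v‖ ^ 2 * Literature.Analysis.FluidPDE.localMaxwellian 1 θ
              (0 : Literature.MathematicalPhysics.KineticTheory.V3) v = 0) →
          ∃ K : ℝ, ∀ Φ : (N : ℕ) → Literature.Analysis.FluidPDE.HardSphereFlow
              (Literature.Analysis.FluidPDE.Torus.geometry (Fin 3))
              (Literature.MathematicalPhysics.KineticTheory.hsDiameter σ N) (N + 1),
          ∀ χ : Literature.MathematicalPhysics.KineticTheory.T3 → ℝ, Continuous χ → ∀ s : ℝ,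
            Tendsto (fun N : ℕ => ((N : ℝ) + 1) *
                cov[fun z => ∫ y, χ y.1 * h y.2 ∂(Literature.Analysis.FluidPDE.empiricalMeasure
                      ((Φ N).flow (s * ((N : ℝ) + 1) ^ (-(1 / 3 : ℝ))) z)),
                    fun z => ∫ y, χ y.1 * h y.2 ∂(Literature.Analysis.FluidPDE.empiricalMeasure z);
                  Literature.MathematicalPhysics.KineticTheory.localGibbsLaw σ (fun _ => 1)
                    (fun _ => 0) (fun _ => θ) N (Φ N)])
              atTop (𝓝 ((∫ x, χ x * χ x) * K *
                ⟪F.koopman (Real.sqrt θ / σ * s)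
                    (F.fluct (Literature.MathematicalPhysics.KineticTheory.cellObs
                      (fun w => h (Real.sqrt θ • w)))),
                  F.fluct (Literature.MathematicalPhysics.KineticTheory.cellObs
                    (fun w => h (Real.sqrt θ • w)))⟫_ℝ))) →
    Summit.AtomisticToContinuum.HydrodynamicLimit.Theses.MourreKoopmanCharges.ChargesCompleteHS →
    Summit.AtomisticToContinuum.HydrodynamicLimit.Theses.MourreKoopmanCharges.OneBodyCompleteness := by
  intro h1 h2 h3
  obtain ⟨z₀, hz₀, hcomplete⟩ := h3 1 one_pos 1 one_pos
  obtain ⟨z₂, hz₂, hident⟩ := h2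
  obtain ⟨σ₁, hσ₁, hframe⟩ := h1 (min z₀ z₂) (lt_min hz₀ hz₂)
  refine ⟨min σ₁ (1 / 2), lt_min hσ₁ one_half_pos, ?_⟩
  intro σ hσ hσlt θ hθ h hh hbound hm0 hm1 hm2 Φ χ hχ δ hδ
  have hσ1 : σ < σ₁ := lt_of_lt_of_le hσlt (min_le_left _ _)
  have hσhalf : σ < 1 / 2 := lt_of_lt_of_le hσlt (min_le_right _ _)
  obtain ⟨F, z, hz, hzlt, hGibbs, hflow, hdens, hcont, hobs⟩ := hframe σ hσ hσ1
  have hz0 : z < z₀ := lt_of_lt_of_le hzlt (min_le_left _ _)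
  have hz2 : z < z₂ := lt_of_lt_of_le hzlt (min_le_right _ _)
  -- the rescaled profile h_θ = h (√θ ·)
  have hhθ : Continuous fun w : Literature.MathematicalPhysics.KineticTheory.V3 => h (Real.sqrt θ • w) :=
    hh.comp (continuous_const_smul (Real.sqrt θ))
  have hboundθ := poly_bound_comp_sqrt (θ := θ) hbound
  obtain ⟨hm0', hm1', hm2'⟩ := orthogonal_comp_sqrt hθ hm0 hm1 hm2
  obtain ⟨hmem, horth⟩ := hobs (fun w => h (Real.sqrt θ • w)) hhθ hboundθ
  have horth' : ∀ i : Fin 5,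
      ⟪F.fluct (Literature.MathematicalPhysics.KineticTheory.cellObs fun w => h (Real.sqrt θ • w)),
        F.chargeClass i⟫_ℝ = 0 :=
    horth hm0' hm1' hm2'
  -- charges are complete for the framework data (route item ChargesCompleteHS at σ = β = 1)
  have hcc : F.ChargesComplete := hcomplete z hz hz0 F hGibbs hflow
  -- ψ = [A_{h_θ}] is orthogonal to the conserved space 𝒬₀ ⊆ 𝒞 = span (q_i)
  set ψ := F.fluct (Literature.MathematicalPhysics.KineticTheory.cellObs fun w => h (Real.sqrt θ • w))
    with hψdef
  have hperp : ∀ φ ∈ F.conservedSpace, ⟪ψ, φ⟫_ℝ = 0 := by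
    intro φ hφ
    have hφ' : φ ∈ Submodule.span ℝ (Set.range F.chargeClass) := hcc hφ
    obtain ⟨a, rfl⟩ := (Submodule.mem_span_range_iff_exists_fun ℝ).1 hφ'
    rw [inner_sum]
    refine Finset.sum_eq_zero fun i _ => ?_
    rw [real_inner_smul_right, horth' i, mul_zero]
  -- mean ergodic theorem: Cesàro decay of ⟪U_u ψ, ψ⟫, then of the time-rescaled version
  have hκ : 0 < Real.sqrt θ / σ := div_pos (Real.sqrt_pos.2 hθ) hσ
  have hME := meanErgodic 1 F hcont ψ hperp
  have hMEκ := tendsto_cesaro_comp_mul (φ := fun u => ⟪F.koopman u ψ, ψ⟫_ℝ) hκ hME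
  -- identification constant and pointwise convergence of (N+1)·cov
  obtain ⟨K, hK⟩ := hident σ hσ hσhalf z hz hz2 θ hθ F hGibbs hflow hdens h hh hbound hmem hm0 hm1 hm2
  have hcov := fun s : ℝ => hK Φ χ hχ s
  -- continuity of the limit profile g(s) = (∫χ²) K ⟪U_{κ s} ψ, ψ⟫
  have hgc : Continuous fun s : ℝ => (∫ x, χ x * χ x) * K *
      ⟪F.koopman (Real.sqrt θ / σ * s) ψ, ψ⟫_ℝ :=
    continuous_const.mul (((hcont ψ).comp (continuous_const.mul continuous_id)).inner continuous_const)
  -- torus moments: cov = raw two-time moment, and domination by the equal-time moment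
  have hmom := fun (N : ℕ) (t : ℝ) => stub_torusMoments σ hσ hσhalf θ hθ h hh hbound hm0 N (Φ N) χ hχ t
  -- pointwise convergence of the raw moments
  have hraw : ∀ s : ℝ, Tendsto (fun N : ℕ => ((N : ℝ) + 1) *
      ∫ z, (∫ y, χ y.1 * h y.2 ∂(Literature.Analysis.FluidPDE.empiricalMeasure
          ((Φ N).flow (s * ((N : ℝ) + 1) ^ (-(1 / 3 : ℝ))) z))) *
        (∫ y, χ y.1 * h y.2 ∂(Literature.Analysis.FluidPDE.empiricalMeasure z))
        ∂(Literature.MathematicalPhysics.KineticTheory.localGibbsLaw σ (fun _ => 1)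
          (fun _ => 0) (fun _ => θ) N (Φ N))) atTop
      (𝓝 ((∫ x, χ x * χ x) * K * ⟪F.koopman (Real.sqrt θ / σ * s) ψ, ψ⟫_ℝ)) := by
    intro s
    refine (hcov s).congr fun N => ?_
    rw [(hmom N (s * ((N : ℝ) + 1) ^ (-(1 / 3 : ℝ)))).1]
  -- the equal-time moments converge, hence are bounded
  have hraw0 : Tendsto (fun N : ℕ => ((N : ℝ) + 1) *
      ∫ z, (∫ y, χ y.1 * h y.2 ∂(Literature.Analysis.FluidPDE.empiricalMeasure
          ((Φ N).flow 0 z))) *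
        (∫ y, χ y.1 * h y.2 ∂(Literature.Analysis.FluidPDE.empiricalMeasure z))
        ∂(Literature.MathematicalPhysics.KineticTheory.localGibbsLaw σ (fun _ => 1)
          (fun _ => 0) (fun _ => θ) N (Φ N))) atTop
      (𝓝 ((∫ x, χ x * χ x) * K * ⟪F.koopman (Real.sqrt θ / σ * 0) ψ, ψ⟫_ℝ)) := by
    have h0 := hraw 0
    simp only [zero_mul, mul_zero] at h0 ⊢
    exact h0
  obtain ⟨M, hM⟩ := exists_forall_le_of_tendsto hraw0
  -- uniform domination of the raw moments
  have hbd : ∀ (N : ℕ) (s : ℝ), |((N : ℝ) + 1) *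
      ∫ z, (∫ y, χ y.1 * h y.2 ∂(Literature.Analysis.FluidPDE.empiricalMeasure
          ((Φ N).flow (s * ((N : ℝ) + 1) ^ (-(1 / 3 : ℝ))) z))) *
        (∫ y, χ y.1 * h y.2 ∂(Literature.Analysis.FluidPDE.empiricalMeasure z))
        ∂(Literature.MathematicalPhysics.KineticTheory.localGibbsLaw σ (fun _ => 1)
          (fun _ => 0) (fun _ => θ) N (Φ N))| ≤ M := by
    intro N s
    have hN : (0 : ℝ) ≤ (N : ℝ) + 1 := by positivity
    have hdom := (hmom N (s * ((N : ℝ) + 1) ^ (-(1 / 3 : ℝ)))).2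
    rw [abs_mul, abs_of_nonneg hN]
    exact (mul_le_mul_of_nonneg_left hdom hN).trans (hM N)
  -- the limiting window averages tend to zero (mean ergodic theorem, rescaled time)
  have hL : Tendsto (fun S : ℝ => S⁻¹ * ∫ s in (0 : ℝ)..S, (∫ x, χ x * χ x) * K *
      ⟪F.koopman (Real.sqrt θ / σ * s) ψ, ψ⟫_ℝ) atTop (𝓝 0) := by
    have e : (fun S : ℝ => S⁻¹ * ∫ s in (0 : ℝ)..S, (∫ x, χ x * χ x) * K *
        ⟪F.koopman (Real.sqrt θ / σ * s) ψ, ψ⟫_ℝ) =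
        fun S : ℝ => (∫ x, χ x * χ x) * K * (S⁻¹ * ∫ s in (0 : ℝ)..S,
          ⟪F.koopman (Real.sqrt θ / σ * s) ψ, ψ⟫_ℝ) := by
      funext S
      rw [intervalIntegral.integral_const_mul]
      ring
    rw [e]
    simpa using hMEκ.const_mul ((∫ x, χ x * χ x) * K)
  -- choose the window threshold S₀
  obtain ⟨S₁, hS₁⟩ := Metric.tendsto_atTop.1 hL (δ / 2) (half_pos hδ)
  refine ⟨max S₁ 1, lt_of_lt_of_le one_pos (le_max_right _ _), ?_⟩
  intro S hS
  have hSpos : 0 < S := lt_of_lt_of_le one_pos ((le_max_right _ _).trans hS)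
  have hLS := hS₁ S ((le_max_left _ _).trans hS)
  rw [Real.dist_eq, sub_zero] at hLS
  -- window passage on the torus: eventually in N
  have hW := stub_windowPassage (fun (N : ℕ) (s : ℝ) => ((N : ℝ) + 1) *
      ∫ z, (∫ y, χ y.1 * h y.2 ∂(Literature.Analysis.FluidPDE.empiricalMeasure
          ((Φ N).flow (s * ((N : ℝ) + 1) ^ (-(1 / 3 : ℝ))) z))) *
        (∫ y, χ y.1 * h y.2 ∂(Literature.Analysis.FluidPDE.empiricalMeasure z))
        ∂(Literature.MathematicalPhysics.KineticTheory.localGibbsLaw σ (fun _ => 1)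
          (fun _ => 0) (fun _ => θ) N (Φ N)))
    (fun s : ℝ => (∫ x, χ x * χ x) * K * ⟪F.koopman (Real.sqrt θ / σ * s) ψ, ψ⟫_ℝ)
    M hgc hbd hraw S hSpos (δ / 2) (half_pos hδ)
  obtain ⟨N₀, hN₀⟩ := eventually_atTop.1 hW
  refine ⟨N₀, fun N hN => ?_⟩
  have hNS := hN₀ N hN
  linarith [hNS, hLS]


end Summit.AtomisticToContinuum.HydrodynamicLimit.Theorems.MourreKoopmanChargesOneBodyCompleteness

end
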